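import Literature.AlgebraicGeometry.Frobenioids.QuasiTemperoidGaloisPadicFields
import Literature.AlgebraicGeometry.Frobenioids.QuasiTemperoidGaloisFieldsEquivalence
import Literature.AlgebraicGeometry.Frobenioids.PadicLocalDiscreteValuation
import Literature.AnabelianGeometry.SemiGraphs.TemperoidsGaloisObjectsProofs
import HarnessLib

/-!
# [FrdII] Thm. 2.4 (i), base binder `H_ram` DISCHARGED for the Galois-correspondence base
# `B^temp(G_{ℚ_p})⁰ → D₀`: every `p`-adic field has covers of every ramification index

Mochizuki, *The geometry of Frobenioids II*, Kyushu J. Math. **62** (2008) 401–460, §2, Theorem 2.4 (i),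
proof p. 20 ll. 9–28 [cite: MochizukiFrdII2008, Thm 2.4 (i) p.20]: fieldwise saturation of `Φᵢ` is read off
"by varying `B`" over the base, in particular over covers `Spec K_B → Spec K_C` along which the value group
grows; the sub-DAG `plan/L1/SUBDAG-FrdII-Thm24.md`, row W12-L01 (abc-iut-w5-d229,
`PadicFieldwiseSaturatedCriterion.lean`), isolates the base property used as the binder

  `hram : ∀ (C : D) (N : ℕ), 0 < N → ∃ (B : D) (f : B ⟶ C), ∀ a : OrdInt (d.fld C),
     ∃ b : OrdInt (d.fld B), ordIntMapOfHom (d.base.map f).alg (d.base.map f).isValHom a = b ^ N`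

("over every `C` and for every `N ≥ 1` some `B → C` makes every class of `ord(O_{K_C}^⊳)` an `N`-th power in
`ord(O_{K_B}^⊳)`", row **W12-L01b-β `H_ram`**, L1-lead R97 (5)(b)). THIS FILE PROVES that property for the
Galois-correspondence base of Example 1.3 (iii) (abc-iut-L1's `QuasiTemperoid.galoisPadicFields p :
B^temp(G_{ℚ_p})⁰ ⥤ PadicFld p`): `QuasiTemperoid.hram_galoisPadicFields`. Classical local algebra:

* `K_C = ℚ̄_p^{Stab(x_C)}` is a finite extension of `ℚ_p` with the `p`-adic valuation
  (`isPadicLocal_galoisPadicFields`), so `ord(O_{K_C}^⊳) ≅ ℤ_{≥0}` has a uniformizer `π`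
  (`PadicFld.isZMonoprime_ordInt`; `exists_uniformizer_galoisPadicFields`);
* choose `α ∈ ℚ̄_p` with `α^N = π` (Eisenstein `X^N − π`; only the root is needed, not irreducibility) and
  let `V := Stab(x_C) ∩ Stab(α)` — OPEN (`ℚ_p(α)` is finite: Krull topology) — and `B := G_{ℚ_p}/V`, a
  connected object mapping to `C` (`gV ↦ g·x_C`); then `K_B = g₀·ℚ̄_p^{V} ∋ g₀α` for the base point
  `x_B = g₀V`, the field map `K_C → K_B` of the cover is `a ↦ g₀·a`, Galois automorphisms are ISOMETRIES
  (`isValHom_restrictBetween`), and `[g₀π] = [g₀α]^N`; since every class of `ord(O_{K_C}^⊳)` is `[π]^k`, every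
  class becomes an `N`-th power over `B`.

Proof-only (no definitions, no named facts); nothing here bears on [IUTchIII] Cor. 3.12.
-/

noncomputable section

namespace Literature.AlgebraicGeometry.Frobenioids

namespace QuasiTemperoid

open CategoryTheory Topology ValuativeRel
open Literature.AnabelianGeometry.SemiGraphs

variable (p : ℕ) [Fact p.Prime]

/-! ### Integers of the field of a base object -/

/-- In `K_X = ℚ̄_p^{Stab(x_X)}` with its `p`-adic valuation: `x ∈ O_{K_X}^⊳` iff `‖x‖ ≤ 1` (in `ℚ̄_p`) and `x ≠ 0`.
[cite: MochizukiFrdII2008, Ex 1.1 (i) p.7] -/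
theorem mem_intNonzero_galoisPadicFields_iff (X : ConnectedPart (BTemp (GalFbar ℚ_[p])))
    (x : ((galoisPadicFields p).obj X).K) :
    x ∈ PadicFrd.intNonzero ((galoisPadicFields p).obj X).K ↔
      ‖(Subtype.val x : PadicAlgCl p)‖ ≤ 1 ∧ x ≠ 0 := by
  rw [PadicFrd.mem_intNonzero_iff]
  refine and_congr ?_ Iff.rfl
  rw [← map_one (valuation ((galoisPadicFields p).obj X).K), ← Valuation.vle_iff_le]
  have h := subfield_vle_iff p (fixFld ℚ_[p] X) x 1
  rw [IntermediateField.coe_one, norm_one] at h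
  exact h

/-! ### A uniformizer of `K_C` -/

/-- **`ord(O_{K_C}^⊳) ≅ ℤ_{≥0}` has a uniformizer**: some `π ∈ O_{K_C}^⊳` with `[π] ≠ 1` and every class a power
`[π]^k` (`K_C` is a finite extension of `ℚ_p` with the `p`-adic valuation). [cite: MochizukiFrdII2008, Ex 1.1 (i) p.7] -/
theorem exists_uniformizer_galoisPadicFields (C : ConnectedPart (BTemp (GalFbar ℚ_[p]))) :
    ∃ π : PadicFrd.intNonzero ((galoisPadicFields p).obj C).K, Associates.mk π ≠ 1 ∧
      ∀ a : PadicFrd.OrdInt ((galoisPadicFields p).obj C).K, ∃ k : ℕ, a = Associates.mk π ^ k := by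
  obtain ⟨inst, hfin, hc⟩ := (isPadicLocal_galoisPadicFields p C).exists_finite
  letI := inst
  haveI := hfin
  obtain ⟨⟨e⟩⟩ := PadicFrd.PadicFld.isZMonoprime_ordInt ((galoisPadicFields p).obj C) hc
  obtain ⟨π, hπ⟩ := Associates.mk_surjective (e.symm (Multiplicative.ofAdd 1))
  have h1 : e (Associates.mk π) = Multiplicative.ofAdd 1 := by rw [hπ, MulEquiv.apply_symm_apply]
  refine ⟨π, ?_, fun a => ⟨Multiplicative.toAdd (e a), ?_⟩⟩
  · intro h
    rw [h, map_one, ← ofAdd_zero] at h1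
    exact zero_ne_one (Multiplicative.ofAdd.injective h1)
  · rw [hπ, ← map_pow]
    apply e.injective
    rw [MulEquiv.apply_symm_apply, ← ofAdd_nsmul, smul_eq_mul, mul_one, ofAdd_toAdd]

/-! ### The cover `G_{ℚ_p}/V → C`, `V = Stab(x_C) ∩ Stab(α)` -/

/-- The stabiliser of an element `α ∈ ℚ̄_p` in `G_{ℚ_p}` is open: it contains the fixing subgroup of the finite
extension `ℚ_p(α)` (Krull topology). [cite: MochizukiFrdII2008, Ex 1.3 (iii) pp.11-12] -/
theorem isOpen_stabilizer_elem (α : Fbar ℚ_[p]) :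
    IsOpen (MulAction.stabilizer (GalFbar ℚ_[p]) α : Set (GalFbar ℚ_[p])) := by
  haveI : FiniteDimensional ℚ_[p] (IntermediateField.adjoin ℚ_[p] ({α} : Set (Fbar ℚ_[p]))) :=
    IntermediateField.adjoin.finiteDimensional (Algebra.IsIntegral.isIntegral α)
  refine Subgroup.isOpen_mono (H₁ := (IntermediateField.adjoin ℚ_[p] ({α} : Set (Fbar ℚ_[p]))).fixingSubgroup)
    ?_ (IntermediateField.fixingSubgroup_isOpen _)
  intro σ hσ
  rw [MulAction.mem_stabilizer_iff, AlgEquiv.smul_def]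
  exact (IntermediateField.mem_fixingSubgroup_iff _ _).mp hσ α (IntermediateField.mem_adjoin_simple_self ℚ_[p] α)

/-- **`H_ram` for the Galois-correspondence base `B^temp(G_{ℚ_p})⁰ → D₀`** ([FrdII] Thm. 2.4 (i), base richness
used on p. 20: covers of every ramification index): over every object `C` and for every `N ≥ 1` there is a
cover `f : B → C` such that every class of `ord(O_{K_C}^⊳)` becomes an `N`-th power in `ord(O_{K_B}^⊳)`
(`K_B ∋` an `N`-th root of a uniformizer of `K_C`). [cite: MochizukiFrdII2008, Thm 2.4 (i) p.20] -/
theorem hram_galoisPadicFields (C : ConnectedPart (BTemp (GalFbar ℚ_[p]))) (N : ℕ) (hN : 0 < N) :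
    ∃ (B : ConnectedPart (BTemp (GalFbar ℚ_[p]))) (f : B ⟶ C),
      ∀ a : PadicFrd.OrdInt ((galoisPadicFields p).obj C).K,
        ∃ b : PadicFrd.OrdInt ((galoisPadicFields p).obj B).K,
          PadicFrd.ordIntMapOfHom ((galoisPadicFields p).map f).alg ((galoisPadicFields p).map f).isValHom a
            = b ^ N := by
  classical
  have hG : IsTempered (GalFbar ℚ_[p]) := isTempered_galFbar ℚ_[p]
  -- a uniformizer of `K_C` and an `N`-th root of it in `ℚ̄_p`
  obtain ⟨π, -, hπ⟩ := exists_uniformizer_galoisPadicFields p C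
  have hπmem := (mem_intNonzero_galoisPadicFields_iff p C π.1).mp π.2
  have hπ0 : (Subtype.val π.1 : Fbar ℚ_[p]) ≠ 0 := fun h =>
    hπmem.2 (Subtype.ext h)
  obtain ⟨α, hα⟩ := IsAlgClosed.exists_pow_nat_eq (Subtype.val π.1 : Fbar ℚ_[p]) hN
  have hα0 : α ≠ 0 := by
    intro h; rw [h, zero_pow hN.ne'] at hα; exact hπ0 hα.symm
  -- the open subgroup `V = Stab(x_C) ∩ Stab(α)` and the cover `B = G/V`
  set V : Subgroup (GalFbar ℚ_[p]) :=
    stabilizerSubgroup C.obj (basePt C) ⊓ MulAction.stabilizer (GalFbar ℚ_[p]) α with hV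
  have hVopen : IsOpen (V : Set (GalFbar ℚ_[p])) :=
    (isOpen_stabilizerSubgroup C.obj (basePt C)).inter (isOpen_stabilizer_elem p α)
  let B : ConnectedPart (BTemp (GalFbar ℚ_[p])) :=
    ⟨BTemp.quotientObj (GalFbar ℚ_[p]) hG V hVopen, GaloisObjects.isConnectedObj_quotientObj hG V hVopen⟩
  -- the morphism `B → C`, `gV ↦ g · x_C`
  obtain ⟨f₀, hf₀⟩ := GaloisObjects.exists_hom_quotientObj hG V hVopen (X := C.obj) (basePt C)
    (fun k hk => mem_stabilizerSubgroup_iff.mp (Subgroup.mem_inf.mp hk).1)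
  let f : B ⟶ C := ObjectProperty.homMk f₀
  refine ⟨B, f, ?_⟩
  -- the base point of `B` is some coset `g₀ V`; the field map `K_C → K_B` is `a ↦ g₀ · a`
  obtain ⟨g₀, hg₀⟩ := QuotientGroup.mk_surjective (basePt B : (GalFbar ℚ_[p]) ⧸ V)
  have hcarry : C.obj.obj.ρ g₀ (basePt C) = ptMap f (basePt B) := by
    show C.obj.obj.ρ g₀ (basePt C) = f₀.hom.hom (basePt B)
    rw [← hg₀, ← GaloisObjects.quotientObj_ρ_one hG V hVopen g₀, BTempConnected.hom_ρ f₀, hf₀]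
  have hfield : ∀ a : ((galoisPadicFields p).obj C).K,
      (Subtype.val (((galoisPadicFields p).map f).alg a) : Fbar ℚ_[p]) = g₀ (Subtype.val a) := fun a =>
    fieldMap_apply_of_ρ_eq f hcarry a
  -- `β := g₀ · α` lies in `K_B = ℚ̄_p^{Stab(g₀V)}` and is a nonzero integer there
  have hstab : ∀ σ : GalFbar ℚ_[p], B.obj.obj.ρ σ (basePt B) = basePt B → g₀⁻¹ * σ * g₀ ∈ V := by
    intro σ hσ
    rw [← hg₀] at hσ
    have h1 : (g₀ : (GalFbar ℚ_[p]) ⧸ V) = ((σ * g₀ : GalFbar ℚ_[p]) : (GalFbar ℚ_[p]) ⧸ V) := by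
      rw [← GaloisObjects.quotientObj_ρ_mk hG V hVopen σ g₀]; exact hσ.symm
    rw [QuotientGroup.eq, ← mul_assoc] at h1
    exact h1
  have hβmem : g₀ α ∈ fixFld ℚ_[p] B := by
    rw [mem_fixFld_iff]
    intro σ hσ
    have hv : g₀⁻¹ * σ * g₀ ∈ MulAction.stabilizer (GalFbar ℚ_[p]) α :=
      (Subgroup.mem_inf.mp (hstab σ hσ)).2
    rw [MulAction.mem_stabilizer_iff, AlgEquiv.smul_def, AlgEquiv.mul_apply, AlgEquiv.mul_apply,
      AlgEquiv.aut_inv, AlgEquiv.symm_apply_eq] at hv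
    exact hv
  have hnormβ : ‖(g₀ α : PadicAlgCl p)‖ ≤ 1 := by
    have hiso : ‖(g₀ α : PadicAlgCl p)‖ = ‖(α : PadicAlgCl p)‖ := by
      rw [← PadicAlgCl.spectralNorm_eq, ← PadicAlgCl.spectralNorm_eq, ← spectralNorm_eq_of_equiv]
    rw [hiso]
    have hN' : ‖(α : PadicAlgCl p)‖ ^ N ≤ 1 := by
      rw [← norm_pow]
      have e : (α ^ N : PadicAlgCl p) = (Subtype.val π.1 : PadicAlgCl p) := hα
      rw [e]; exact hπmem.1
    exact (pow_le_one_iff_of_nonneg (norm_nonneg _) hN.ne').mp hN'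
  let β₁ : ((galoisPadicFields p).obj B).K := ⟨g₀ α, hβmem⟩
  have hβ₁ : Subtype.val β₁ = g₀ α := rfl
  have hβint : β₁ ∈ PadicFrd.intNonzero ((galoisPadicFields p).obj B).K := by
    refine (mem_intNonzero_galoisPadicFields_iff p B β₁).mpr ⟨?_, fun h => hα0 ?_⟩
    · rw [hβ₁]; exact hnormβ
    · have h' : g₀ α = 0 := by rw [← hβ₁, h]; rfl
      rwa [map_eq_zero_iff _ g₀.injective] at h'
  let β : PadicFrd.intNonzero ((galoisPadicFields p).obj B).K := ⟨β₁, hβint⟩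
  -- `[g₀ · π] = [β]^N` in `ord(O_{K_B}^⊳)`
  have hkey : PadicFrd.ordIntMapOfHom ((galoisPadicFields p).map f).alg ((galoisPadicFields p).map f).isValHom
      (Associates.mk π) = Associates.mk β ^ N := by
    rw [PadicFrd.ordIntMapOfHom_mk, ← Associates.mk_pow]
    refine congrArg Associates.mk (Subtype.ext ?_)
    apply Subtype.ext
    show Subtype.val (((galoisPadicFields p).map f).alg π.1) =
      Subtype.val (Subtype.val (β ^ N : PadicFrd.intNonzero ((galoisPadicFields p).obj B).K))
    rw [hfield, SubmonoidClass.coe_pow]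
    show g₀ (Subtype.val π.1) = Subtype.val (((⟨g₀ α, hβmem⟩ : ↥(fixFld ℚ_[p] B)) ^ N : ↥(fixFld ℚ_[p] B)))
    rw [← hα, map_pow]
    rfl
  intro a
  obtain ⟨k, rfl⟩ := hπ a
  refine ⟨Associates.mk β ^ k, ?_⟩
  rw [map_pow, hkey]
  exact pow_right_comm _ _ _

end QuasiTemperoid

end Literature.AlgebraicGeometry.Frobenioids

end
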